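import Mathlib.Analysis.Complex.Basic
import Mathlib.Analysis.Normed.Field.Basic
import Mathlib.Analysis.Normed.Module.Basic
import Mathlib.Topology.Algebra.Monoid
import Mathlib.Topology.Homeomorph.Defs
import Mathlib.CategoryTheory.Equivalence
import Mathlib.Data.NNReal.Basic
import HarnessLib

/-!
# [IUTchI] Example 3.4: Frobenioids at archimedean primes; split topological monoids `TM⊢`
# (INTERFACE with the monoid-level content REAL)

S. Mochizuki, *Inter-universal Teichmüller theory I*, §3, Example 3.4 "Frobenioids at Archimedean
Primes" (i)–(iii), kurims final manuscript May 2020 pp. 80–82, with Remarks 3.4.2 (p. 82) and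
3.4.3 (i) (p. 83), and the category `TM⊢` of *split topological monoids* of [AbsTopIII] Def. 5.6 (i)
as recalled on p. 81 [claim: Mochizuki2012, status: disputed]. DEFINITIONS (and three one-line
consequences of them); nothing of the series' disputed content is involved.

For `v ∈ V̲^arc` the completion `K_v` is a complex archimedean field; we take it as a Mathlib
`NormedField` with `NormedAlgebra ℝ` structure (the completion at a complex place is such). REAL:
`𝒪^▷_{K_v} = {0 < |z| ≤ 1}` (`unitDiscMonoid`), `𝒪^×_{K_v} = {|z| = 1}`, the "positive real"
submonoid `(0, 1]` (`posRealMonoid`) — i.e. the object of `TM⊢` "determined by" a CAF —, the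
category `TM⊢` itself (`SplitTopMonoid`, `SplitTopMonoid.Hom`: "objects `(C, C→)` … a topological
monoid `C` isomorphic to `𝒪^▷_ℂ` and a topological submonoid `C→ ⊆ C` [necessarily isomorphic to
`ℝ_{≥0}`] such that `C^× × C→ → C` is an isomorphism …; morphisms … isomorphisms of topological
monoids `C₁ ⥲ C₂` that induce isomorphisms `C₁→ ⥲ C₂→`"), the Kummer structure
`κ_v : 𝒪^▷(C_v) ↪ 𝒜_{D_v}` as the composite of the two natural isomorphisms printed in (i) (with
injectivity and continuity PROVED from them), `τ⊢_v`, `Φ_{C⊢_v} ≅ ℝ_{≥0}` with `log(p_v)`,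
`Φ_{C^Θ_v} = ℝ_{≥0}·log(p_v)·log(Θ)`. INTERFACE (inputs absent from the tree, TODO-merge
abc-iut-L4-t2 [AbsTopIII] §2/§4, abc-iut-L1-t4 [FrdII] Ex. 3.3): the Aut-holomorphic orbispaces
`X_v, …, X̲→_v =: D_v` (`S3Local.AutHolOrbispace`, shape only), the CAF `𝒜_{D_v}` "algorithmically
constructed from `D_v`", the archimedean Frobenioid `C_v` as a category with its topological monoid
`𝒪^▷(C_v)`, `C^Θ_v`.

Deliberately NOT here: Rmk 3.4.1 (terminology); Rmk 3.4.2's equivalence "Kummer structure ⟺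
Aut-holomorphic structure on `𝒪^▷(C_v)^gp` + co-holomorphicization" and Rmk 3.4.3 beyond the unit /
torsion subgroups of (i) (holomorphic elliptic and Belyi cuspidalisation, [AbsTopIII] Cor. 2.7,
[AbsTopII] §3 — abc-iut-L4-t2); the reconstruction phrases "may be algorithmically reconstructed
from" of (ii), (iii) are recorded in docstrings only (their content is [AbsTopIII] Cor. 2.7 / Prop.
5.8, typed by abc-iut-L4-t2/t3); the divisor-monoid scalars are in `GlobalRealifiedFrobenioids.lean`.
-/

namespace Literature.IUT.HodgeTheaters

open CategoryTheory
open scoped NNReal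

universe u

/-! ### `𝒪^▷`, `𝒪^×` and the positive reals of a complex archimedean (normed) field -/

section Monoids

variable (A : Type u) [NormedField A]

/-- `𝒪^▷_A`: the multiplicative topological monoid of nonzero elements of norm `≤ 1` of the
archimedean field `A` (§0; Ex. 3.4 (i) "`𝒪^▷_{K_v}`"; p. 81 "`𝒪^▷_ℂ`").
[claim: Mochizuki2012, status: disputed] -/
def unitDiscMonoid : Submonoid A where
  carrier := {z | z ≠ 0 ∧ ‖z‖ ≤ 1}
  mul_mem' := by
    rintro a b ⟨ha, ha'⟩ ⟨hb, hb'⟩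
    refine ⟨mul_ne_zero ha hb, ?_⟩
    rw [norm_mul]
    exact mul_le_one₀ ha' (norm_nonneg _) hb'
  one_mem' := ⟨one_ne_zero, by rw [norm_one]⟩

/-- `𝒪^×_A`: the elements of norm `1`, "the topological submonoid of invertible elements [which is
necessarily isomorphic to `𝕊¹`]" (p. 81; Rmk 3.4.3 (i) "`A^×_□`, the topological group of units
[i.e., of elements of norm `1`]"). [claim: Mochizuki2012, status: disputed] -/
def unitCircleMonoid : Submonoid A where
  carrier := {z | ‖z‖ = 1}
  mul_mem' := by
    intro a b ha hb
    simp only [Set.mem_setOf_eq] at ha hb ⊢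
    rw [norm_mul, ha, hb, mul_one]
  one_mem' := by simp

variable [NormedAlgebra ℝ A]

/-- The "positive real" submonoid `(0, 1] ⊆ 𝒪^▷_A`: the splitting `C→` of the object of `TM⊢`
determined by the CAF `A` (p. 81: "the CAFs `K_v`, `𝒜_{D_v}` determine, in a natural way, objects
of `TM⊢`"), "necessarily isomorphic to `ℝ_{≥0}`" (via `r ↦ −log r`).
[claim: Mochizuki2012, status: disputed] -/
def posRealMonoid : Submonoid A where
  carrier := {z | ∃ r : ℝ, 0 < r ∧ r ≤ 1 ∧ z = algebraMap ℝ A r}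
  mul_mem' := by
    rintro a b ⟨r, hr, hr', rfl⟩ ⟨s, hs, hs', rfl⟩
    exact ⟨r * s, mul_pos hr hs, mul_le_one₀ hr' hs.le hs', by rw [map_mul]⟩
  one_mem' := ⟨1, one_pos, le_rfl, by rw [map_one]⟩

end Monoids

/-! ### The category `TM⊢` of split topological monoids ([AbsTopIII] Def. 5.6 (i), as on p. 81) -/

/-- An object `(C, C→)` of `TM⊢` (p. 81): "a topological monoid `C` isomorphic to `𝒪^▷_ℂ` and a
topological submonoid `C→ ⊆ C` [necessarily isomorphic to `ℝ_{≥0}`] such that the natural inclusions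
`C^× ↪ C`, `C→ ↪ C` determine an isomorphism `C^× × C→ ⥲ C` of topological monoids" (the
bijectivity is recorded; bicontinuity of the product map is then a property of `𝒪^▷_ℂ`).
TODO-merge:abc-iut-L4-t3 [AbsTopIII] Def. 5.6 (i). [claim: Mochizuki2012, status: disputed] -/
structure SplitTopMonoid where
  /-- the topological monoid `C` -/
  C : Type u
  /-- its topology -/
  [instTop : TopologicalSpace C]
  /-- its (commutative) monoid structure -/
  [instMon : CommMonoid C]
  /-- multiplication is continuous -/
  [instCts : ContinuousMul C]
  /-- the splitting `C→ ⊆ C` (the noncompact factor) -/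
  vec : Submonoid C
  /-- "`C` isomorphic to `𝒪^▷_ℂ`" as a topological monoid -/
  iso_unitDisc : ∃ e : C ≃* unitDiscMonoid ℂ, Continuous e ∧ Continuous e.symm
  /-- "`C^× × C→ ⥲ C`": every element is uniquely a unit times an element of `C→` -/
  split : Function.Bijective (fun p : Cˣ × vec => (p.1 : C) * (p.2 : C))

attribute [instance] SplitTopMonoid.instTop SplitTopMonoid.instMon SplitTopMonoid.instCts

/-- A morphism `(C₁, C₁→) → (C₂, C₂→)` of `TM⊢` (p. 81): "isomorphisms of topological monoids
`C₁ ⥲ C₂` that induce isomorphisms `C₁→ ⥲ C₂→`". [claim: Mochizuki2012, status: disputed] -/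
structure SplitTopMonoid.Hom (M N : SplitTopMonoid.{u}) where
  /-- the isomorphism of monoids -/
  iso : M.C ≃* N.C
  /-- it is a homeomorphism: continuous … -/
  continuous : Continuous iso
  /-- … with continuous inverse -/
  continuous_symm : Continuous iso.symm
  /-- it carries `C₁→` onto `C₂→` -/
  map_vec : M.vec.map iso.toMonoidHom = N.vec

/-- The compact factor `C^×` of an object of `TM⊢` (p. 81: "`𝒪^×_{C⊢_v}`, the compact factor").
[claim: Mochizuki2012, status: disputed] -/
abbrev SplitTopMonoid.compact (M : SplitTopMonoid.{u}) : Type u := M.Cˣ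

/-! ### Local stubs -/

namespace S3Local

/-- TODO-merge:abc-iut-L4-t2 [AbsTopIII] Def. 2.1 (i) — an *Aut-holomorphic orbispace*: an
underlying topological (orbi)space together with the group of "holomorphic" self-homeomorphisms as
a datum; only the shape is recorded (Ex. 3.4 (i): `X_v, C_v, X̲_v, C̲_v, X̲→_v, C̲→_v`).
[claim: Mochizuki2012, status: disputed] -/
structure AutHolOrbispace where
  /-- the underlying topological space -/
  carrier : Type u
  /-- its topology -/
  [instTop : TopologicalSpace carrier]
  /-- the Aut-holomorphic structure: a group of self-homeomorphisms -/
  autHol : Subgroup (carrier ≃ₜ carrier)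

attribute [instance] AutHolOrbispace.instTop

end S3Local

/-! ### Example 3.4 -/

/-- **[IUTchI] Example 3.4** (Frobenioids at archimedean primes), pp. 80–82, for `v ∈ V̲^arc` with
completion `K_v` (a complex archimedean field, here a normed `ℝ`-algebra field): the data (i)–(iii),
one field (group) per printed object. [claim: Mochizuki2012, status: disputed] -/
structure ArchLocalFrobenioid (Kv : Type u) [NormedField Kv] [NormedAlgebra ℝ Kv] where
  /-- (i) `D_v := X̲→_v`, the Aut-holomorphic orbispace determined by `X̲→_K` at `v` -/
  Dv : S3Local.AutHolOrbispace.{u}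
  /-- (i) `𝒜_{D_v}`, "a complex archimedean topological field [i.e., a CAF] which may be
  algorithmically constructed from" `D_v` ([AbsTopIII] Def. 4.1 (i), Cor. 2.7) … -/
  Afield : Type u
  /-- … a normed field … -/
  [instAfield : NormedField Afield]
  /-- … and normed `ℝ`-algebra … -/
  [instAfieldAlg : NormedAlgebra ℝ Afield]
  /-- … which is a CAF: bicontinuously isomorphic to `ℂ` -/
  caf : ∃ e : Afield ≃+* ℂ, Continuous e ∧ Continuous e.symm
  /-- (i) `C_v`, "the archimedean Frobenioid as in [FrdII], Example 3.3, (ii), where we take the base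
  category to be the one-morphism category determined by `Spec(K_v)`" (TODO-merge:abc-iut-L1-t4) -/
  Cv : Type u
  /-- category structure on `C_v` -/
  [instCv : Category.{u} Cv]
  /-- (i) "`𝒪^▷(C_v)`", the topological monoid "reconstructed category-theoretically from `C`"
  ([FrdI] Thm. 3.4 (iii); [FrdII] Thm. 3.6 (i), (vii)) … -/
  OC : Type u
  /-- … its topology … -/
  [instOCTop : TopologicalSpace OC]
  /-- … its commutative monoid structure … -/
  [instOCMon : CommMonoid OC]
  /-- … with continuous multiplication -/
  [instOCCts : ContinuousMul OC]
  /-- (i) "by construction, there is a natural isomorphism `𝒪^▷(C_v) ⥲ 𝒪^▷_{K_v}` of topological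
  monoids" (REAL target `unitDiscMonoid K_v`) … -/
  isoOK : OC ≃* unitDiscMonoid Kv
  /-- … continuous … -/
  isoOK_continuous : Continuous isoOK
  /-- … with continuous inverse -/
  isoOK_continuous_symm : Continuous isoOK.symm
  /-- (i) "there is a natural topological isomorphism `K_v ⥲ 𝒜_{D_v}`" … -/
  fieldIso : Kv ≃+* Afield
  /-- … continuous … -/
  fieldIso_continuous : Continuous fieldIso
  /-- … with continuous inverse -/
  fieldIso_continuous_symm : Continuous fieldIso.symm
  /-- (iii) `C^Θ_v`, "a new split Frobenioid `(C^Θ_v, τ^Θ_v)`, isomorphic to `(C⊢_v, τ⊢_v)`" with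
  `𝒪^▷(C^Θ_v) = 𝒪^×_{C^Θ_v} × Φ_{C^Θ_v}` (TODO-merge:abc-iut-L1-t4) … -/
  CTheta : Type u
  /-- category structure on `C^Θ_v` -/
  [instCTheta : Category.{u} CTheta]
  /-- … with "a natural isomorphism of split Frobenioids `(C⊢_v, τ⊢_v) ⥲ (C^Θ_v, τ^Θ_v)`, obtained by
  'forgetting the formal symbol `log(Θ)`'" (an equivalence of the underlying categories; `C⊢_v := C_v`) -/
  dashThetaEquiv : Cv ≌ CTheta

attribute [instance] ArchLocalFrobenioid.instAfield ArchLocalFrobenioid.instAfieldAlg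
  ArchLocalFrobenioid.instCv ArchLocalFrobenioid.instOCTop ArchLocalFrobenioid.instOCMon
  ArchLocalFrobenioid.instOCCts ArchLocalFrobenioid.instCTheta

namespace ArchLocalFrobenioid

variable {Kv : Type u} [NormedField Kv] [NormedAlgebra ℝ Kv]

/-- (i) The **Kummer structure** on `C_v`: "`κ_v : 𝒪^▷(C_v) ↪ 𝒜_{D_v}`", the restriction to
`𝒪^▷_{K_v}` of `K_v ⥲ 𝒜_{D_v}` composed with `𝒪^▷(C_v) ⥲ 𝒪^▷_{K_v}` — "an inclusion of topological
monoids" (DEFINED from the two printed isomorphisms). [claim: Mochizuki2012, status: disputed] -/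
noncomputable def kappa (X : ArchLocalFrobenioid.{u} Kv) : X.OC →* X.Afield :=
  ((X.fieldIso : Kv →+* X.Afield) : Kv →* X.Afield).comp
    (((unitDiscMonoid Kv).subtype).comp X.isoOK.toMonoidHom)

/-- `κ_v` is injective ("inclusion") — PROVED from the definitions. [claim: Mochizuki2012, status: disputed] -/
theorem kappa_injective (X : ArchLocalFrobenioid.{u} Kv) : Function.Injective X.kappa := by
  intro a b h
  have h1 : X.fieldIso ((X.isoOK a : unitDiscMonoid Kv) : Kv) =
      X.fieldIso ((X.isoOK b : unitDiscMonoid Kv) : Kv) := h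
  exact X.isoOK.injective (Subtype.ext (X.fieldIso.injective h1))

/-- `κ_v` is continuous ("of topological monoids") — PROVED from the definitions.
[claim: Mochizuki2012, status: disputed] -/
theorem kappa_continuous (X : ArchLocalFrobenioid.{u} Kv) : Continuous X.kappa :=
  X.fieldIso_continuous.comp (continuous_subtype_val.comp X.isoOK_continuous)

/-- (i) `F̲_v := (C_v, D_v, κ_v)`, "the [ordered] triple" — the structure `X` itself together with
`kappa`; recorded as the triple of its components' types. [claim: Mochizuki2012, status: disputed] -/
noncomputable def FvTriple (X : ArchLocalFrobenioid.{u} Kv) : Type u × S3Local.AutHolOrbispace.{u} × (X.OC →* X.Afield) := (X.Cv, X.Dv, X.kappa)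

/-- (ii) `τ⊢_v`, "the resulting characteristic splitting of the Frobenioid `C⊢_v := C_v`, i.e., so
that we may think of the pair `(𝒪^▷(C⊢_v), τ⊢_v)` as the object of `TM⊢` determined by `K_v`": the
preimage of the positive reals `(0, 1] ⊆ 𝒪^▷_{K_v}`. [claim: Mochizuki2012, status: disputed] -/
def tauDash (X : ArchLocalFrobenioid.{u} Kv) : Submonoid X.OC :=
  ((posRealMonoid Kv).comap (unitDiscMonoid Kv).subtype).comap X.isoOK.toMonoidHom

/-- (ii) `𝒪^×_{C⊢_v}`, the compact factor (units of `𝒪^▷(C⊢_v)`), "isomorphic — but not canonically! —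
to the compact factor of `D⊢_v`" (Cor. 3.9 (ii)). [claim: Mochizuki2012, status: disputed] -/
abbrev unitsDash (X : ArchLocalFrobenioid.{u} Kv) : Type u := X.OCˣ

/-- (ii) `D⊢_v`, "the object of `TM⊢` determined by `𝒜_{D_v}`": the pair
`(𝒪^▷_{𝒜_{D_v}}, (0,1])`, recorded by its two REAL components. [claim: Mochizuki2012, status: disputed] -/
def DdashPair (X : ArchLocalFrobenioid.{u} Kv) : Submonoid X.Afield × Submonoid X.Afield :=
  (unitDiscMonoid X.Afield, posRealMonoid X.Afield)

/-- (ii) "the object `(𝒪^▷(C⊢_v), τ⊢_v)` of `TM⊢` is isomorphic to `D⊢_v`" — typed as a statement: an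
isomorphism of monoids `𝒪^▷(C⊢_v) ⥲ 𝒪^▷_{𝒜_{D_v}}`, bicontinuous, carrying `τ⊢_v` onto `(0, 1]`.
[claim: Mochizuki2012, status: disputed] -/
def DashIsoDdash (X : ArchLocalFrobenioid.{u} Kv) : Prop :=
  ∃ e : X.OC ≃* unitDiscMonoid X.Afield, Continuous e ∧ Continuous e.symm ∧
    X.tauDash.map e.toMonoidHom = (posRealMonoid X.Afield).comap (unitDiscMonoid X.Afield).subtype

/-- (iii) `Φ_{C⊢_v}`, "the noncompact factor … isomorphic, as a topological monoid, to `ℝ_{≥0}`; let us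
write `Φ_{C⊢_v}` additively", coordinatised by "`log(p_v)`, the element determined by `p_v`" `↦ 1`
(`p_v = e`, §0). [claim: Mochizuki2012, status: disputed] -/
abbrev PhiDash (_X : ArchLocalFrobenioid.{u} Kv) : Type := ℝ≥0

/-- (iii) `log(p_v) ∈ Φ_{C⊢_v}` — "a generator of `Φ_{C⊢_v}`" relative to the `ℝ_{≥0}`-action.
[claim: Mochizuki2012, status: disputed] -/
def logp (X : ArchLocalFrobenioid.{u} Kv) : X.PhiDash := 1

/-- (iii) `Φ_{C^Θ_v} := ℝ_{≥0}·log(p_v)·log(Θ)`, "a new topological monoid … isomorphic to `ℝ_{≥0}`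
that is generated by a formal symbol `log(p_v)·log(Θ)`" (`↦ 1`). [claim: Mochizuki2012, status: disputed] -/
abbrev PhiTheta (_X : ArchLocalFrobenioid.{u} Kv) : Type := ℝ≥0

/-- (iii) `𝒪^×_{C^Θ_v} := 𝒪^×_{C⊢_v}`. [claim: Mochizuki2012, status: disputed] -/
abbrev unitsTheta (X : ArchLocalFrobenioid.{u} Kv) : Type u := X.OCˣ

/-- (iii) the natural isomorphism `Φ_{C⊢_v} ⥲ Φ_{C^Θ_v}`, `log(p_v) ↦ log(p_v)·log(Θ)`, underlying
"`F⊢_v ⥲ F^Θ_v`", `F^Θ_v := (C^Θ_v, D^Θ_v := D⊢_v, τ^Θ_v)`. [claim: Mochizuki2012, status: disputed] -/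
def phiDashToTheta (X : ArchLocalFrobenioid.{u} Kv) : X.PhiDash ≃+ X.PhiTheta := AddEquiv.refl _

/-- Rmk 3.4.3 (i): "`A^μ_□ ⊆ A^×_□`, the subgroup of torsion elements [so `A^μ_□` is noncanonically
isomorphic to `ℚ/ℤ`]" of the CAF — the roots of unity of `𝒜_{D_v}`. [claim: Mochizuki2012, status: disputed] -/
def torsionUnits (X : ArchLocalFrobenioid.{u} Kv) : Submonoid X.Afield where
  carrier := {z | ∃ n : ℕ, 0 < n ∧ z ^ n = 1}
  mul_mem' := by
    rintro a b ⟨m, hm, ha⟩ ⟨n, hn, hb⟩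
    refine ⟨m * n, Nat.mul_pos hm hn, ?_⟩
    rw [mul_pow, pow_mul, ha, one_pow, mul_comm m n, pow_mul, hb, one_pow, one_mul]
  one_mem' := ⟨1, one_pos, one_pow 1⟩

/-- Rmk 3.4.3 (i): torsion units have norm `1` (`A^μ_□ ⊆ A^×_□`) — PROVED.
[claim: Mochizuki2012, status: disputed] -/
theorem torsionUnits_le_unitCircle (X : ArchLocalFrobenioid.{u} Kv) : X.torsionUnits ≤ unitCircleMonoid X.Afield := by
  rintro z ⟨n, hn, hz⟩
  have h : ‖z‖ ^ n = 1 := by rw [← norm_pow, hz, norm_one]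
  exact (pow_eq_one_iff_of_nonneg (norm_nonneg z) hn.ne').mp h

end ArchLocalFrobenioid

/-! ### Addendum (referee G3-F1): the printed TOPOLOGICAL splitting condition of `TM⊢` -/

/-- Referee finding G3-F1 (ref-g) on `SplitTopMonoid.split`: print (p. 81, [AbsTopIII] Def. 5.6 (i))
asks that "the natural inclusions `C^× ↪ C`, `C→ ↪ C` determine an isomorphism `C^× × C→ ⥲ C` of
TOPOLOGICAL monoids"; the field `split` records only the bijectivity of the product map, a declared
WIDENING (a non-measurable `C→` inside `𝒪^▷_ℂ` can have a bijective but not bicontinuous product map).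
The printed condition is THIS predicate: the product map is a homeomorphism. The objects of interest
(`𝒪^▷` of a CAF with `(0, 1]`) satisfy it; statements over "all `M : SplitTopMonoid`" ([AbsTopIII]
Prop. 5.8 (vi)) should assume it. [claim: Mochizuki2012, status: disputed] -/
def SplitTopMonoid.IsTopSplit (M : SplitTopMonoid.{u}) : Prop :=
  ∃ h : (M.Cˣ × M.vec) ≃ₜ M.C, ∀ p : M.Cˣ × M.vec, h p = (p.1 : M.C) * (p.2 : M.C)

/-- A topologically split `M` is split in the (wider) sense of the structure — PROVED.
[claim: Mochizuki2012, status: disputed] -/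
theorem SplitTopMonoid.IsTopSplit.bijective {M : SplitTopMonoid.{u}} (hM : M.IsTopSplit) :
    Function.Bijective (fun p : M.Cˣ × M.vec => (p.1 : M.C) * (p.2 : M.C)) := by
  obtain ⟨h, hh⟩ := hM
  have : (fun p : M.Cˣ × M.vec => (p.1 : M.C) * (p.2 : M.C)) = h := funext fun p => (hh p).symm
  rw [this]
  exact h.bijective

end Literature.IUT.HodgeTheaters
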